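import Summits.AtomisticToContinuum.Crystallization.Theses.FluxTubeKepler

/-!
# `FluxCellKepler` (stmt-AtomisticToContinuum-15221), line `Sketch` — helper III: monotonicity of the
# defect predicate and reduction of the pricing to a cofinal family of scales

Two bookkeeping facts about the crux's defect predicate ("site `i` is `(R, η)`-layered-good": its
`R`-neighbourhood is two-way `η`-matched with a member of the relaxed Barlow / layered family):

* `stub_goodMono` — goodness is ANTITONE in the radius and MONOTONE in the tolerance:
  good at `(R', η')` with `R ≤ R'`, `η' ≤ η` implies good at `(R, η)`.  Hence the bad count
  `#bad_(R,η)` is monotone in `R` and antitone in `η`.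
* `stub_pricingOfCofinal` — consequently a linear defect pricing `c · #bad_(R,η) ≤ F(x)` (any
  right-hand side `F`, e.g. `E_LJ − N e*` for the τ-free stub or `Σ λ − N e(P₀)` for KEPLER) holds
  at EVERY scale `(R, η)` as soon as it holds along a cofinal family of scales (radii `R' ≥ R`,
  tolerances `η' ≤ η`), with the same constants: it suffices to prove KEPLER for large `R` and
  small `η`.
-/

namespace Summit.AtomisticToContinuum.Crystallization.Theorems.FluxCellKeplerSketch

open scoped BigOperators
open Literature.MathematicalPhysics.StatisticalMechanics

/-- **Monotonicity of the layered-good predicate**: good at `(R', η')` implies good at `(R, η)`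
whenever `R ≤ R'` and `η' ≤ η` (same witnesses `a, A, s, z`). [folklore] -/
theorem stub_goodMono : ∀ (R R' η η' : ℝ), R ≤ R' → η' ≤ η → ∀ (N : ℕ) (x : Fin N → EuclideanSpace ℝ (Fin 3)) (i : Fin N), (∃ a : ℝ, 47 / 50 ≤ a ∧ a ≤ 1 ∧ ∃ (A : EuclideanSpace ℝ (Fin 3) →ₗᵢ[ℝ] EuclideanSpace ℝ (Fin 3)) (s : ℤ → ℤ) (z : ℤ → ℝ), IsHaggSeq s ∧ (∀ m : ℤ, 39 / 50 * a ≤ z (m + 1) - z m ∧ z (m + 1) - z m ≤ 17 / 20 * a) ∧ let S : Set (EuclideanSpace ℝ (Fin 3)) := {p | ∃ m k l : ℤ, p = A (((k : ℝ) • triangularVec₁ a) + ((l : ℝ) • triangularVec₂ a) + ((haggLabel s m : ℝ) • barlowOffset a) + (z m • layerNormal 1))}; (∀ p ∈ S, ‖p‖ ≤ R' → ∃ j : Fin N, dist (x j - x i) p ≤ η') ∧ (∀ j : Fin N, ‖x j - x i‖ ≤ R' → ∃ p ∈ S, dist (x j - x i) p ≤ η')) → (∃ a : ℝ, 47 / 50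 ≤ a ∧ a ≤ 1 ∧ ∃ (A : EuclideanSpace ℝ (Fin 3) →ₗᵢ[ℝ] EuclideanSpace ℝ (Fin 3)) (s : ℤ → ℤ) (z : ℤ → ℝ), IsHaggSeq s ∧ (∀ m : ℤ, 39 / 50 * a ≤ z (m + 1) - z m ∧ z (m + 1) - z m ≤ 17 / 20 * a) ∧ let S : Set (EuclideanSpace ℝ (Fin 3)) := {p | ∃ m k l : ℤ, p = A (((k : ℝ) • triangularVec₁ a) + ((l : ℝ) • triangularVec₂ a) + ((haggLabel s m : ℝ) • barlowOffset a) + (z m • layerNormal 1))}; (∀ p ∈ S, ‖p‖ ≤ R → ∃ j : Fin N, dist (x j - x i) p ≤ η) ∧ (∀ j : Fin N, ‖x j - x i‖ ≤ R → ∃ p ∈ S, dist (x j - x i) p ≤ η)) := by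
  intro R R' η η' hRR' hηη' N x i h
  obtain ⟨a, ha₁, ha₂, A, s, z, hs, hz, h₁, h₂⟩ := h
  refine ⟨a, ha₁, ha₂, A, s, z, hs, hz, ?_, ?_⟩
  · intro p hp hpR
    obtain ⟨j, hj⟩ := h₁ p hp (hpR.trans hRR')
    exact ⟨j, hj.trans hηη'⟩
  · intro j hj
    obtain ⟨p, hp, hpj⟩ := h₂ j (hj.trans hRR')
    exact ⟨p, hp, hpj.trans hηη'⟩

/-- **Pricing along a cofinal family of scales suffices.** If for every `(R, η)` there are
`R' ≥ R`, `0 < η' ≤ η` and `c > 0` with `c · #bad_(R',η') ≤ F(x)` on all `δ`-separated finite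
injective `x`, then for every `(R, η)` some `c > 0` gives `c · #bad_(R,η) ≤ F(x)` on the same
configurations (indeed the same `c`, by `stub_goodMono`). [folklore] -/
theorem stub_pricingOfCofinal : ∀ (δ : ℝ) (F : (N : ℕ) → (Fin N → EuclideanSpace ℝ (Fin 3)) → ℝ), (∀ R η : ℝ, 0 < R → 0 < η → ∃ R' η' : ℝ, R ≤ R' ∧ 0 < η' ∧ η' ≤ η ∧ ∃ c : ℝ, 0 < c ∧ ∀ (N : ℕ) (x : Fin N → EuclideanSpace ℝ (Fin 3)), Function.Injective x → (∀ i j, i ≠ j → δ ≤ dist (x i) (x j)) → c * (Nat.card {i : Fin N // ¬ ∃ a : ℝ, 47 / 50 ≤ a ∧ a ≤ 1 ∧ ∃ (A : EuclideanSpace ℝ (Fin 3) →ₗᵢ[ℝ] EuclideanSpace ℝ (Fin 3)) (s : ℤ → ℤ) (z : ℤ → ℝ), IsHaggSeq s ∧ (∀ m : ℤ, 39 / 50 * a ≤ z (m + 1) - z m ∧ z (m + 1) - z m ≤ 17 / 20 * a) ∧ let S : Set (EuclideanSpace ℝ (Fin 3)) := {p | ∃ m k l : ℤ, p = A (((k :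 ℝ) • triangularVec₁ a) + ((l : ℝ) • triangularVec₂ a) + ((haggLabel s m : ℝ) • barlowOffset a) + (z m • layerNormal 1))}; (∀ p ∈ S, ‖p‖ ≤ R' → ∃ j : Fin N, dist (x j - x i) p ≤ η') ∧ (∀ j : Fin N, ‖x j - x i‖ ≤ R' → ∃ p ∈ S, dist (x j - x i) p ≤ η')} : ℝ) ≤ F N x) → ∀ R η : ℝ, 0 < R → 0 < η → ∃ c : ℝ, 0 < c ∧ ∀ (N : ℕ) (x : Fin N → EuclideanSpace ℝ (Fin 3)), Function.Injective x → (∀ i j, i ≠ j → δ ≤ dist (x i) (x j)) → c * (Nat.card {i : Fin N // ¬ ∃ a : ℝ, 47 / 50 ≤ a ∧ a ≤ 1 ∧ ∃ (A : EuclideanSpace ℝ (Fin 3) →ₗᵢ[ℝ] EuclideanSpace ℝ (Fin 3)) (s : ℤ → ℤ) (z : ℤ → ℝ), IsHaggSeq s ∧ (∀ m : ℤ, 39 / 50 * a ≤ z (m + 1) - z m ∧ z (m + 1) - z m ≤ 17 / 20 * a) ∧ let S : Set (EuclideanSpace ℝ (Fin 3)) := {p | ∃ m k l : ℤ, p = A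 (((k : ℝ) • triangularVec₁ a) + ((l : ℝ) • triangularVec₂ a) + ((haggLabel s m : ℝ) • barlowOffset a) + (z m • layerNormal 1))}; (∀ p ∈ S, ‖p‖ ≤ R → ∃ j : Fin N, dist (x j - x i) p ≤ η) ∧ (∀ j : Fin N, ‖x j - x i‖ ≤ R → ∃ p ∈ S, dist (x j - x i) p ≤ η)} : ℝ) ≤ F N x := by
  intro δ F hcof R η hR hη
  obtain ⟨R', η', hRR', hη'0, hη'η, c, hc, hP⟩ := hcof R η hR hη
  refine ⟨c, hc, fun N x hx hsep => ?_⟩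
  refine le_trans ?_ (hP N x hx hsep)
  refine mul_le_mul_of_nonneg_left ?_ hc.le
  classical
  rw [Nat.card_eq_fintype_card, Nat.card_eq_fintype_card]
  refine Nat.cast_le.2 (Fintype.card_subtype_mono _ _ ?_)
  intro i hi hgood
  exact hi (stub_goodMono R R' η η' hRR' hη'η N x i hgood)

end Summit.AtomisticToContinuum.Crystallization.Theorems.FluxCellKeplerSketch
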